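import Mathlib
import HarnessLib
import HarnessLib.Audit
import Summits.AtomisticToContinuum.Statement
import Literature.MathematicalPhysics.StatisticalMechanics.LennardJonesClusters
import Summits.AtomisticToContinuum.Crystallization.Theorems.PalmUnimodularRigidityCrysPeriodicBddBelow

/-!
Route: CoexistenceMuGSC

CLOSED (retired) 2026-08-15T13:41:17Z by operator:999:1257524 — reason: not-a-thesis: assembly does not conclude the sub-problem Statement — note: D-0027 §2.1 audit (human 2026-08-15: routes that do not decide the summit are removed): the assembly concludes `Literature.MathematicalPhysics.StatisticalMechanics.Crystallization`, not the sub-problem statement; a NEW conforming route may be opened from the same idea (generated `closes : … → _root_. The file is kept as the record of this route; refuted decls are indexed as negative knowledge (`ledger negatives`).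

# Route CoexistenceMuGSC — Grand-canonical selection — ground-state limits are μGSCs at μ = e*, so
Crystallization reduces to crystallinity of solid coexistence μGSCs plus a no-sponge lemma

Write e* := lim E(N)/N (= inf_N E(N)/N, Fekete; in tree `BlancLewin2015_8_holds`) and call X ⊆ ℝ³ a
μGSC at μ (Sütő's
μ-ground-state configuration, distinct-points convention) if no finite modification — remove n
points, insert k distinct points off
the rest — lowers U − μ·#. X = CoexistenceMuGSCCrystalline: there is a FINITE family P₁,…,P_m of
periodic configurations such that
every non-empty uniformly discrete μGSC of Lennard-Jones at the coexistence potential μ = e*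
contains, for every radius R and
tolerance δ, a ball of radius R on which it is two-way δ-matched to a rigid image of some P_l
(family fixed BEFORE R, δ — the card's
"some periodic P" per (R, δ) would be vacuous). It suffices because the support layer (provable now,
potential-independent) turns
every sequence of finite ground states into such μGSCs: choosing N at (1/j, j)-local minima of the
surface staircase a_N = E(N) − N e*
(SelectedGrandStability; needs only a_N ≥ 0 and a_N = o(N)) makes ground states at those N minimise
E − e*·# up to 1/j against ALL
configurations with particle number within j, so every local limit is a μGSC at μ = e* containing 0
(MuGSCLimitExtraction); near-periodic
balls at all scales in the limit give IsCrystallizing (WindowsCrystallize), and the removal test on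
the matched balls pins
e(P_l) ≤ e* = inf over periodic Q, i.e. attainment and E(N)/N → e(P_l) (PinnedPeriodicAttains +
CrysEnergyUpper + CrysPeriodicBddBelow).
X is filed as the target and split into crux 2 (SolidMuGSCCrystalline: μGSCs containing a large
solid ball are near-crystalline somewhere)
and crux 3 (MuGSCSolidBalls: every non-empty coexistence μGSC contains arbitrarily large solid balls
— finite surface tension, no sponges);
X ⇐ crux 2 ∧ crux 3 is one line. Realises card grand-canonical-selection-coexistence (its S1–S4 =
the support items, its C1 = the target).
Lean: `let UD : Set (EuclideanSpace ℝ (Fin 3)) → Prop := fun X => ∃ δ : ℝ, 0 < δ ∧ ∀ x ∈ X, ∀ y ∈ X,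
x ≠ y → δ ≤ dist x y; let Match : ℝ → ℝ → EuclideanSpace ℝ (Fin 3) → Set (EuclideanSpace ℝ (Fin 3))
→ Set (EuclideanSpace ℝ (Fin 3)) → Prop := fun δ R c A S => (∀ s ∈ S, dist s c ≤ R → ∃ a ∈ A, dist a
s ≤ δ) ∧ (∀ a ∈ A, dist a c ≤ R → ∃ s ∈ S, dist a s ≤ δ); let MuGSC : ℝ → Set (EuclideanSpace ℝ (Fin
3)) → Prop := fun μ X => (∀ r : EuclideanSpace ℝ (Fin 3), Summable fun y : X =>
Literature.MathematicalPhysics.StatisticalMechanics.lennardJones (dist r y)) ∧ ∀ (n : ℕ) (xf : Fin n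
→ EuclideanSpace ℝ (Fin 3)), Function.Injective xf → Set.range xf ⊆ X → ∀ (k : ℕ) (R : Fin k →
EuclideanSpace ℝ (Fin 3)), Function.Injective R → Disjoint (Set.range R) (X \ Set.range xf) →
Literature.MathematicalPhysics.StatisticalMechanics.interactionEnergy
Literature.MathematicalPhysics.StatisticalMechanics.lennardJones xf + (∑ i, ∑' y : ↥(X \ Set.range
xf), Literature.MathematicalPhysics.StatisticalMechanics.lennardJones (dist (xf i) y)) - μ * n ≤
Literature.MathematicalPhysics.StatisticalMechanics.interactionEnergy
Literature.MathematicalPhysics.StatisticalMechanics.lennardJones R + (∑ i, ∑' y : ↥(X \ Set.range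
xf), Literature.MathematicalPhysics.StatisticalMechanics.lennardJones (dist (R i) y)) - μ * k; ∀ e :
ℝ, Filter.Tendsto (fun N : ℕ =>
Literature.MathematicalPhysics.StatisticalMechanics.groundStateEnergy
Literature.MathematicalPhysics.StatisticalMechanics.lennardJones 3 N / N) Filter.atTop (nhds e) → ∃
(m : ℕ) (P : Fin m → Literature.MathematicalPhysics.StatisticalMechanics.PeriodicConfiguration 3), ∀
R δ : ℝ, 0 < R → 0 < δ → ∀ X : Set (EuclideanSpace ℝ (Fin 3)), X.Nonempty → UD X → MuGSC e X → ∃ (l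
: Fin m) (g : EuclideanSpace ℝ (Fin 3) ≃ᵃⁱ[ℝ] EuclideanSpace ℝ (Fin 3)) (c : EuclideanSpace ℝ (Fin
3)), Match δ R c X (g '' (P l).points)`

## Assembly
e exists with E(N)/N → e, e ≤ E(N)/N (N ≥ 1), e < 0 (BlancLewin2015_8_holds 3). (ii)
IsCrystallizing: WindowsCrystallize needs, for every
ground-state sequence x, a locally convergent selected subsequence with uniformly discrete limit X
carrying near-P_l balls at all scales:
SelectedGrandStability gives φ₀, MuGSCLimitExtraction gives (φ, τ, X) with 0 ∈ X, X uniformly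
discrete and a μGSC at e; MuGSCSolidBalls gives
r₁ and, X being non-empty, solid balls of every radius; SolidMuGSCCrystalline (with that r₁) gives
m, P and the matched balls. (i)
HasPeriodicGroundStateEnergy: take any ground-state sequence (LennardJonesGroundStatesExist_holds),
its limit X as above, pigeonhole one l₀ hit
for (R, δ) = (k, 1/k) infinitely often (matching is monotone: larger R and smaller δ imply the
weaker one), PinnedPeriodicAttains gives
e(P_{l₀}) ≤ e; CrysEnergyUpper + CrysPeriodicBddBelow + Tendsto.limsup_eq give e ≤ ⨅_Q e(Q) ≤ e(Q)
for all Q; hence e(P_{l₀}) = e is least and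
E(N)/N → e(P_{l₀}). Conjunction = Literature…Crystallization (as in
crystallization_of_isLeast_tendsto_isCrystallizing). Difficulty S–M
(pigeonhole over Fin m, limsup = lim, match monotonicity); the target CoexistenceMuGSCCrystalline
itself follows from cruxes 2 ∧ 3 in one line.

Rationale: WHY THIS LINE. The statement leaves the subsequence φ free, and the route spends that freedom on the
ENERGY SEQUENCE before any geometry: at the foot of a
step of the surface staircase a finite cluster is simultaneously in equilibrium with vacuum and with
the infinite crystal, so its local limits
are zero-temperature GRAND-CANONICAL equilibria at the crystal/vacuum coexistence potential μ = e* —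
Sütő's μGSCs (Suto2006 §2, SutoPRL2005;
the class G of BellissardRadinShlosman2010 §2 / Radin2004 at the special value λ = −e*), for which
Kossel–Stranski's kink rule
(doi:10.1098/rsta.1951.0006 §1–2: kink binding = lattice energy per particle) becomes a two-sided
POINTWISE theorem: no particle bound by
less than |e*|, no empty site binding by more, for arbitrary finite insertions/removals
(KosselPointwise, BlancLewin2015 §1.2 (6) made pointwise).
Imported area: the infinite-volume ground-state-configuration formalism of classical statistical
mechanics (Radin1984, Radin2004,
BellissardRadinShlosman2010, Suto2005/2006/2011) and crystal-growth thermodynamics (Kossel 1927,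
Stranski 1928, Burton–Cabrera–Frank 1951);
no spectral/probabilistic reformulation is used — the Palm/Benjamini–Schramm cards average where
this line is deterministic and pointwise.
What it does that the open routes do not: CrystalKissingRigidity / CrystalLocalRigidity price
defects by energy DENSITY at fixed N (o(N)
exceptional particles, certified local inequalities, Hägg numerics for attainment); here point
defects, cavities, porous and low-dimensional
pieces are excluded by one-line insertion/removal tests at μ = e*, attainment of the periodic
minimum is a COROLLARY of the removal test on a
matched ball (no stacking numerics enter (i) beyond what the target hides), and refuters get a
sharper sieve: a candidate exotic minimiser must
survive every finite insertion at μ = e*. The negatives index is empty; nothing here restates a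
refuted statement.

RANKED CRUXES. #0 CoexistenceMuGSCCrystalline (target) — X as in § Thesis: for e = lim E(N)/N there
are m and periodic P₁..P_m such that every non-empty uniformly discrete μGSC X of Lennard-Jones at μ
= e has, for all R, δ > 0, some l, rigid motion g and centre c with X ∩ B_R(c) and g(P_l.points) ∩
B_R(c) two-way δ-matched (card C1 = GC-CRYSTAL, with the family quantified first). (why it might
fail: A μ-stable LJ state at μ=e* that is nowhere near-periodic at some scale refutes it even if
Crystallization survives via other translations: aperiodic optimal Barlow stacking if Hägg
domination |J₂|>Σk|J_k| fails (margin ~1e-4, uncertified), or a Radin-type aperiodic GSC.)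
[BlancLewin2015, Suto2006, BellissardRadinShlosman2010, Radin1991,
Literature.Barriers.AtomisticToContinuum.AperiodicTilingGroundStates,
stmt-AtomisticToContinuum-0670]
#2 SolidMuGSCCrystalline (crux) — for e = lim E(N)/N and every r₁ > 0 there are m and periodic
P₁..P_m such that for all R, δ > 0 there is R' with: every uniformly discrete μGSC X of
Lennard-Jones at μ = e that r₁-covers some ball of radius R' (a SOLID ball: every point of the ball
within r₁ of X) is two-way δ-matched on some ball of radius R to a rigid image of some P_l (bulk
positional order for μ-stable solid LJ matter at coexistence; card C1 restricted to solid states).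
[difficulty: XL] (why it might fail: Bulk positional order for LJ under the sharpest free
hypotheses, open in d=3: fails iff a solid μ-stable state at μ=e* is nowhere near-periodic at one
scale — aperiodic optimal stacking if |J₂|≤Σk|J_k| (uncertified 1e-4 margin) or frustrated
icosahedral order surviving all insertion tests.) [BlancLewin2015, FlatleyTheil2015, Theil2006,
Suto2006, BellissardRadinShlosman2010,
Literature.Barriers.AtomisticToContinuum.KissingTwelveDegeneracy,
Literature.Barriers.AtomisticToContinuum.AperiodicTilingGroundStates,
stmt-AtomisticToContinuum-0716]
#3 MuGSCSolidBalls (crux) — for e = lim E(N)/N there is r₁ > 0 such that every non-empty uniformly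
discrete μGSC of Lennard-Jones at μ = e contains, for every R', a ball of radius R' each point of
which lies within r₁ of the configuration (coexistence μGSCs are solid somewhere at every scale: no
slabs, needles, foams or sponges — the finite-volume content of positive crystal/vacuum surface
tension, via removal of large chunks and insertion into cavities). [difficulty: L] (why it might
fail: Positivity of the LJ crystal–vacuum surface tension in finite-volume pointwise form: fails iff
a porous, slab-, needle- or sponge-like configuration is μ-stable at μ=e*; no rigorous σ>0 or
hole-pricing bound exists off-lattice in 3-D (2-D: AuYeung–Friesecke–Schmidt; 3-D only on FCC/HCP
lattices).) [AuYeungFrieseckeSchmidt2012, Schmidt2013, doi:10.1007/s00220-023-04788-5,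
doi:10.1098/rsta.1951.0006, HeitmannRadin1980, BlancLewin2015]
#9 SelectedGrandStability (support) — SELECTION LEMMA + GRAND STABILITY (card S1+S2): if E(N)/N → e
and e ≤ E(N)/N for all N ≥ 1 (both in tree: BlancLewin2015_8_holds), there is a strictly increasing
φ such that for every j and every M with |M − φ(j)| ≤ j: E(φ j) − e·φ(j) ≤ E(M) − e·M + 1/(j+1).
Proof: a_N := E(N) − N e ≥ 0 with a_N/N → 0; fix j, pick L with max_{N ≤ 3L} a_N ≤ L/(4j(j+1));
descend from N₀ = 2L by steps of length ≤ j lowering a by > 1/(j+1): at most a_{N₀}(j+1) ≤ L/(4j)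
steps, displacement < L/4, so the chain stops inside (7L/4, 9L/4) at a (1/(j+1), j)-local minimum;
these exist beyond every bound, choose φ increasing. No bounded increments and no N^{2/3} law are
needed (the card's version silently used attainment). [difficulty: provable-now] [BlancLewin2015,
Summits/AtomisticToContinuum/Crystallization/Ideas/grand-canonical-selection-coexistence.md]
#9 MuGSCLimitExtraction (support) — μGSC LIMITS (card S3): given e and a strictly increasing φ₀ with
the grand-stability windows of SelectedGrandStability, every sequence of LJ ground states x^N admits
a subsequence φ (of φ₀), translations τ_j (minus a particle position) and a set X ∋ 0, uniformly
discrete, which is a μGSC at μ = e (summable LJ fields; stable under every finite modification with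
arbitrary particle-number change, inserted points distinct and off the rest) and to which x^{φ j} +
τ_j converges locally: for all R, δ, eventually two-way δ-matching on B_R(0). Proof: uniform minimal
distance (LennardJonesMinimalDistance_holds) ⇒ Chabauty/diagonal compactness of δ-separated pointed
sets; a finite modification of X is shadowed for large j by a modification of x^{φ j} changing the
particle number by k − n ≤ j, whose cost is ≥ −1/(j+1) by grand stability (E(y) ≥ E(#y) via
groundStateEnergy_lennardJones_le); pass to the limit with continuity of V_LJ off 0 and the uniform
r⁻⁶ tail bound for δ-separated sets (shell counting as in sum_inv_pow_six_le). [difficulty: L]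
[Radin2004, BellissardRadinShlosman2010, Suto2006, BlancLewin2015, Xue1997]
#9 WindowsCrystallize (support) — WINDOW LEMMA (card assembly step; the μ-analogue of
DefectVanishCrystallizes 0752): if every LJ ground-state sequence has a subsequence converging
locally (two-way matching on balls around 0, after translations) to a uniformly discrete set X which
carries, for a finite family P₁..P_m and all R, δ, a ball two-way δ-matched to a rigid image of some
P_l, then IsCrystallizing lennardJones 3. Proof: pigeonhole a fixed l along (R_k, δ_k) = (k, 1/k);
re-centre at the good balls (τ'_k = τ_{j_k} − c_k, lattice part of the translation absorbed by
P-invariance, bounded remainder and the O(3)-part converge along a subsequence: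
PeriodicConfiguration.isometryImage / translate); compose matchings with radius margins; the uniform
minimal distance of ground states (LennardJonesMinimalDistance_holds) and
tendsto_sum_of_eventually_near' (CrystallizationLocalLimit, in tree) give local weak-* convergence
to Σ_{s ∈ A(P_l)+t} δ_s with multiplicity 1. [difficulty: M] [BlancLewin2015,
Literature.MathematicalPhysics.StatisticalMechanics.PeriodicConfiguration.tendsto_sum_of_eventually_near']
#9 PinnedPeriodicAttains (support) — PINNING ⇒ ATTAINMENT (card: "one line because removal is
allowed"): if a uniformly discrete X is μ-stable (any μ) and contains, for all R, δ, a ball two-way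
δ-matched to a rigid image of a fixed periodic Q, then e(Q) ≤ μ. Proof: removal test on W = X ∩
B_R(c): U(W) + I(W, X∖W) ≤ μ·n_W; I(W, X∖W) ≥ −C_X R² (δ_X-separation, r⁻⁶ tail across a sphere);
U(W) ≥ U(Q-window) − C n_W δ (energy Lipschitz in positions at separation ≥ δ_Q/2) and U(Q-window ∩
B_R) = n_W e(Q) + O(R²) (each motif class counted n_W/#F + O(R²) times;
hasSum_lennardJones_dist_three); divide by n_W ≍ R³ and let R → ∞, δ → 0. With CrysEnergyUpper +
CrysPeriodicBddBelow (e ≤ e(Q) ∀ Q) this yields IsLeast and E(N)/N → e(P_l) for any P_l charged by a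
μGSC limit. [difficulty: L] [Suto2006, BlancLewin2015,
Literature.MathematicalPhysics.StatisticalMechanics.PeriodicConfiguration.hasSum_lennardJones_dist_three]
#9 KosselPointwise (support) — TWO-SIDED KOSSEL BOUNDS AT SELECTED N (card S4; delivers the open
pointwise item of card kossel-squeeze-surface-relations): if N = n+1 is a (ε,1)-local minimum of
E(·) − e·(·) (both neighbours), then in every N-particle LJ ground state (R) every particle has site
energy Σ_{k≠i} V(r_ik) ≤ e + ε — no atom bound by less than the kink value |e| — and (I) every empty
point y binds by at most |e| + ε: Σ_i V(|y − x_i|) ≥ e − ε. Proof: delete particle i (energy E −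
site_i ≥ E(n)) resp. insert y (energy E + Σ_i V ≥ E(n+2)) and use the two window inequalities;
siteEnergy and the removal bookkeeping are in LennardJonesClusters.lean. Along
SelectedGrandStability's φ, ε = 1/(j+1). [difficulty: provable-now] [doi:10.1098/rsta.1951.0006,
BlancLewin2015,
Literature.MathematicalPhysics.StatisticalMechanics.siteEnergy_nonpos_of_isGroundState]
#9 CrysEnergyUpper (support) — shared bookkeeping item stmt-AtomisticToContinuum-0629 (route
CrystalLocalRigidity): limsup E(N)/N ≤ ⨅ over periodic configurations of the LJ energy per particle
(finite blocks of a periodic configuration as trial states, boundary O(N^{2/3}), r⁻⁶ tail;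
coboundedness from lennardJones_stable_holds). Used with CrysPeriodicBddBelow to get e* ≤ e(Q) for
every periodic Q. [difficulty: M] [BlancLewin2015, stmt-AtomisticToContinuum-0629]
#9 CrysPeriodicBddBelow (support) — shared bookkeeping item stmt-AtomisticToContinuum-0714: the LJ
energy per particle of periodic configurations of ℝ³ is bounded below (stability constant via finite
blocks), making ⨅_Q e(Q) a genuine infimum (ciInf_le) in the assembly. [difficulty: M]
[BlancLewin2015, stmt-AtomisticToContinuum-0714,
Literature.MathematicalPhysics.StatisticalMechanics.lennardJones_stable_holds]

TWO-LAYER PLAN. Foreseen glued splits (nothing filed now; k ≤ 3, depth 1). SolidMuGSCCrystalline ⇐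
LocalOrderFromMuStability (in a solid μ-stable region all
particles off an O(R²)-boundary layer have twelve-shells Cη-close to the FCC/HCP kissing patterns —
removal of over- /under-coordinated atoms
and insertion of missing cap atoms are first order in the well depth, energy comparison handles the
rest) → StackingPropagation (Barlow
fragments that are μ-stable at μ = e* select one near-periodic stacking on sub-balls: Hägg
domination 0716/0737 + certified couplings 0670,
shared with the other routes) → SolidMuGSCCrystalline. MuGSCSolidBalls ⇐ TwoSidedPinning (0 ≤ U(W) −
n_W e* ≤ −I(W, X∖W) ≤ C·area(∂W) for
every finite W ⊆ X, provable now) → PorosityGap (a uniformly discrete configuration in which every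
R₀-ball has an r₁-hole has energy per
particle ≥ e* + η on large chunks) → MuGSCSolidBalls. MuGSCLimitExtraction ⇐ LocalLimitExists
(Chabauty compactness of δ-separated pointed
sets, Mathlib-only) → MuStabilityPasses (grand stability survives local limits) →
MuGSCLimitExtraction.

KILL CRITERIA. An explicit uniformly discrete μ-stable LJ configuration at μ = e* with no
near-periodic ball at some scale refutes the target and crux 2:
close `refuted:SolidMuGSCCrystalline` UNLESS the witness is provably not a local limit of finite
ground states along selected N — then pivot
(route edit --restate) to the subclass of selected-limit μGSCs, which is BulkDefectVanish-strength
and should be merged into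
CrystalKissingRigidity rather than kept as a separate line. A porous/slab/needle μ-stable witness
refutes crux 3: same pivot. Certified
failure of Hägg domination (0670 resolving as |J₂| ≤ Σ_{k≥3} k|J_k| with an aperiodic 1-D ground
stacking) kills the target as stated
(finite family) and, via RefuteCrystalPeriodicMin, the conjunct itself. BulkDefectVanish (0751) +
0627 proved elsewhere moot the cruxes;
the support layer (selection, μGSC limits, pinning) stays useful to every route and is not a reason
to keep this one open.

NOT DECOMPOSED YET. The local-order and stacking-propagation children of crux 2 and the porosity-gap
child of crux 3 (layer 2, after a crux moves); the value of
r₁ (any r₁ above the covering radius ≈ 0.71 of the optimal close packing should do; crux 3 only asks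
∃ r₁); certified bounds on e* that make
the insertion test (I) quantitative (truth e* ≈ −0.7175; in-tree stability constant is far weaker) —
wanted by refuters, not by the assembly;
OptimalPeriodicIsMuGSC (the e*-optimal periodic configuration is itself a μGSC at μ = e*: a
profitable finite modification repeated with a
large period would beat e* — consistency of the class, provable once 0627 closes, not load-bearing);
the surface structure of μGSC limits
(facets/steps/kinks à la Kossel) and Wulff shapes; a separate Chabauty-compactness item. All wait
for crux 2 or 3 to move.

CHEAPEST FALSIFIER. For the target: the certified interlayer couplings of item 0670 (route
RefuteCrystalPeriodicMin) — if |J₂| ≤ Σ_{k≥3} k|J_k| on the relaxed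
(a, h)-box and the 1-D Hägg model has a non-periodic ground stacking, coexistence μGSCs are
aperiodic stackings and the finite-family target is
false (current uncertified numerics: J₂ ≈ −7.3e−5, domination ratio ≈ 250, i.e. safe). For crux 3: a
numerical check that every low-index
facet of the relaxed hcp/fcc LJ crystal has POSITIVE surface energy and that filling any cavity of
radius ≥ 1 at μ = e* lowers E − e*·#
(lattice sums; kit job not run this session — hub compute-free, refuters first). For the support
layer nothing: they are theorems; the card's
database test (Cambridge Cluster Database N ≤ 1610: at (ε,K)-local minima of E(N) − N·e_hcp every
atom must bind by ≥ |e*| − ε ≈ 0.717 and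
every empty site by ≤ |e*| + ε) can only decertify published numerics.

NUMBERS. e* ≈ −8.610/12 = −0.7175 in tree units (V_LJ = r⁻¹²/12 − r⁻⁶/6, well depth 1/12; hcp below
fcc by ~1e−4 relative, Stillinger2001,
BlancLewin2015 §2.3); kink binding = |e*| (BCF 1951 §1); bulk site energy 2e* ≈ −1.435; in-tree
minimal distance δ = 1/3
(LennardJonesMinimalDistance_holds), true ≈ 0.90 (compressed Mackay cores); covering radius of the
close packing at spacing a* ≈ 0.971:
≈ 0.71 (octahedral hole); selection windows K_j = j, tolerance 1/(j+1); items at open: 11 (1 target,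
2 cruxes, 7 support, 1 assembly).

DEFINITION REQUESTS. IsMuGSC (μ-ground-state configuration of a radial real pair potential with the
distinct-points convention: summable fields + stability of
U − μ·# under finite modifications with arbitrary particle-number change; Suto2006 §2 Def., the
μ-version of the tree's canonical
Literature.Barriers.AtomisticToContinuum.Suto.IsGSC) — topic
Summits/AtomisticToContinuum/Crystallization/Theorems; the statements above
inline it as a `let`, together with UD (uniform discreteness) and Match (two-way δ-matching on a
ball); a landed definition would let tenure
restate them readably. No cite facts wanted: every fact used (Fekete limit, stability, minimal
distance, existence) is proved in tree.

Novelty: Searches (2026-08-15): `lit frontier AtomisticToContinuum --since 2020` (30 rows;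
crystallization-side only arXiv:2407.20762 and
arXiv:2604.19239 Kreutz–Ziereis, reference-lattice polycrystal Γ-limits — context, no GSC notion);
`lit bridges AtomisticToContinuum --cross any`
(0 relevant); `lit search --hybrid "ground state configurations chemical potential local stability
Lennard-Jones coexistence"` (15 textbook
hits, none relevant); `lit search --source crossref "ground state configurations chemical potential
classical lattice gas aperiodic Miekisz
Radin"` (Radin1991 RMP, Miekisz 1987/1998, Miękisz–Radin 1986 — lattice models, prescribed μ); `lit
search --source crossref "Radin existence
of ground state configurations"` (RadinSchulman1983, Radin1984, Radin 1986); `lit search --source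
crossref "Wulff crystals atomistic FCC HCP"`
(doi:10.1007/s00220-023-04788-5); read arXiv:0907.5393 §2 (BellissardRadinShlosman2010: G =
configurations stable under all bounded
modifications of Σ U + λ|ω|, hard core + finite range, Theorem 1: zero-temperature limits of Gibbs
states are carried by G; [Ra2] = Radin2004:
G ≠ ∅); `lit galaxy search "ground state configuration chemical potential" --star all` queued > 90 s
(no rows); openalex / S2 / arXiv APIs
HTTP 429 this session (the card's two refuter audits already swept crossref/zbMATH for the selection
mechanism: not found).
Nearest prior art found: BellissardRadinShlosman2010 §2 with Radin2004 (the grand-canonical GSC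
class at general λ, existe  [refs: 10.1007/s00220-023-04788-5, 10.1098/rsta.1951.0006, 10.1007/bf01009521, 2407.20762, 2604.19239, 0907.5393, doi:10.1007/s00220-023-04788-5, doi:10.1098/rsta.1951.0006, doi:10.1007/bf01009521, Radin1991, RadinSchulman1983, Radin1984, BellissardRadinShlosman2010, Radin2004, Suto2006, SutoPRL2005, BlancLewin2015]

Barriers (technique_class: grand-canonical-selection, mu-gsc-coexistence): - technique_class: grand-canonical-selection, mu-gsc-coexistence
- Literature.Barriers.AtomisticToContinuum.SutoDegenerateGroundStates: applies as a warning on μGSC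
classes (continuous degeneracy at prescribed ρ > ρ_d or prescribed μ for band-limited φ̂ ≥ 0,
aperiodic unions included); evasion: LJ is outside Suto.IsAdmissible (scope caveat (b)) and μ = e* =
inf_N E(N)/N is the ZERO-PRESSURE coexistence value, where even Sütő's family is non-degenerate
(SutoDegenerateGroundStatesNarrow, caveat (d)); the route claims nothing potential-generic and ties
the class to finite clusters (vacuum is a μGSC at the same μ).
- Literature.Barriers.AtomisticToContinuum.AperiodicTilingGroundStates: applies to the target's
universal quantifier over μGSCs (model-generic "local stability ⇒ periodicity" is false:
Berger/Robinson tilings, Miękisz's stable aperiodic lattice gases, Radin's two-species continuum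
example); it does not evade it generically; the bet is the residual gap the barrier itself records
(ONE species, RADIAL Lennard-Jones, d = 3) plus the extra structure of coexistence (μ = e* pins
every finite chunk two-sidedly: 0 ≤ U(W) − n_W e* ≤ C·area), and the declared kill criterion if an
aperiodic LJ μGSC appears.
- Literature.Barriers.AtomisticToContinuum.Hubbard1978_mostHomogeneous: applies to the
stacking-selection content hidden in crux 2 (1-D long-range effective models have non-periodic
ground states at prescribed μ or irrational density); evasion: zero pressure / free density, and

History (route lifecycle, newest last):
- 2026-08-15T13:41:17Z · CLOSED retired — not-a-thesis: assembly does not conclude the sub-problem Statement (operator:999:1257524)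

sub-problem: Crystallization · status: closed(retired) · opened planner-plancard-AtomisticToContinuum-Crystal-eac2c9c6-0 2026-08-15T11:28:18Z · rev 0 · ledger route-AtomisticToContinuum-CoexistenceMuGSC
GENERATED by the gate from the ledger (D-0016/17). Provers cite these decls: `theorem foo : Summit.AtomisticToContinuum.Crystallization.Theses.CoexistenceMuGSC.<Decl> := …` in Summits/AtomisticToContinuum/Crystallization/Theorems/<Name>.lean.
-/

namespace Summit.AtomisticToContinuum.Crystallization.Theses.CoexistenceMuGSC

open scoped BigOperators Topology Manifold Classical MeasureTheory ProbabilityTheory Matrix InnerProductSpace ComplexConjugate ContinuousMap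
open Filter Set Function TopologicalSpace MeasureTheory

attribute [summit_statement] _root_.Crystallization

/-- item stmt-AtomisticToContinuum-4119 · target · rank 0 · closed · moot by None · by planner
why it might fail: A μ-stable LJ state at μ=e* that is nowhere near-periodic at some scale refutes it even if Crystallization survives via other translations: aperiodic optimal Barlow stacking if Hägg domination |J₂|>Σk|J_k| fails (margin ~1e-4, uncertified), or a Radin-type aperiodic GSC.
sources: BlancLewin2015, Suto2006, BellissardRadinShlosman2010, Radin1991, Literature.Barriers.AtomisticToContinuum.AperiodicTilingGroundStates, stmt-AtomisticToContinuum-0670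
[target] X as in § Thesis: for e = lim E(N)/N there are m and periodic P₁..P_m such that every
non-empty uniformly discrete μGSC X of Lennard-Jones at μ = e has, for all R, δ > 0, some l, rigid
motion g and centre c with X ∩ B_R(c) and g(P_l.points) ∩ B_R(c) two-way δ-matched (card C1 =
GC-CRYSTAL, with the family quantified first). -/
@[route_item "route-AtomisticToContinuum-CoexistenceMuGSC"]
def CoexistenceMuGSCCrystalline : Prop :=
  let UD : Set (EuclideanSpace ℝ (Fin 3)) → Prop := fun X => ∃ δ : ℝ, 0 < δ ∧ ∀ x ∈ X, ∀ y ∈ X, x ≠ y → δ ≤ dist x y; let Match : ℝ → ℝ → EuclideanSpace ℝ (Fin 3) → Set (EuclideanSpace ℝ (Fin 3)) → Set (EuclideanSpace ℝ (Fin 3)) → Prop := fun δ R c A S => (∀ s ∈ S, dist s c ≤ R → ∃ a ∈ A, dist a s ≤ δ) ∧ (∀ a ∈ A, dist a c ≤ R → ∃ s ∈ S, dist a s ≤ δ); let MuGSC : ℝ → Set (EuclideanSpace ℝ (Fin 3)) → Prop := fun μ X => (∀ r : EuclideanSpace ℝ (Fin 3), Summable fun y : X => Literature.MathematicalPhysics.StatisticalMechanics.lennardJones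 (dist r y)) ∧ ∀ (n : ℕ) (xf : Fin n → EuclideanSpace ℝ (Fin 3)), Function.Injective xf → Set.range xf ⊆ X → ∀ (k : ℕ) (R : Fin k → EuclideanSpace ℝ (Fin 3)), Function.Injective R → Disjoint (Set.range R) (X \ Set.range xf) → Literature.MathematicalPhysics.StatisticalMechanics.interactionEnergy Literature.MathematicalPhysics.StatisticalMechanics.lennardJones xf + (∑ i, ∑' y : ↥(X \ Set.range xf), Literature.MathematicalPhysics.StatisticalMechanics.lennardJones (dist (xf i) y)) - μ * n ≤ Literature.MathematicalPhysics.StatisticalMechanics.interactionEnergy Literature.MathematicalPhysics.StatisticalMechanics.lennardJones R + (∑ i, ∑' y : ↥(X \ Set.range xf), Literature.MathematicalPhysics.StatisticalMechanics.lennardJones (dist (R i) y)) - μ * k; ∀ e : ℝ, Filter.Tendsto (fun N : ℕ => Literature.MathematicalPhysics.StatisticalMechanics.groundStateEnergy Literature.MathematicalPhysics.StatisticalMechanics.lennardJones 3 N / N) Filter.atTop (nhds e) → ∃ (m : ℕ) (P : Fin m → Literature.MathematicalPhysics.StatisticalMechanics.PeriodicConfiguration 3), ∀ R δ : ℝ,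 0 < R → 0 < δ → ∀ X : Set (EuclideanSpace ℝ (Fin 3)), X.Nonempty → UD X → MuGSC e X → ∃ (l : Fin m) (g : EuclideanSpace ℝ (Fin 3) ≃ᵃⁱ[ℝ] EuclideanSpace ℝ (Fin 3)) (c : EuclideanSpace ℝ (Fin 3)), Match δ R c X (g '' (P l).points)

/-- item stmt-AtomisticToContinuum-4120 · crux · rank 2 · closed · moot by None · by planner
why it might fail: Bulk positional order for LJ under the sharpest free hypotheses, open in d=3: fails iff a solid μ-stable state at μ=e* is nowhere near-periodic at one scale — aperiodic optimal stacking if |J₂|≤Σk|J_k| (uncertified 1e-4 margin) or frustrated icosahedral order surviving all insertion tests.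
sources: BlancLewin2015, FlatleyTheil2015, Theil2006, Suto2006, BellissardRadinShlosman2010, Literature.Barriers.AtomisticToContinuum.KissingTwelveDegeneracy
[crux] for e = lim E(N)/N and every r₁ > 0 there are m and periodic P₁..P_m such that for all R, δ >
0 there is R' with: every uniformly discrete μGSC X of Lennard-Jones at μ = e that r₁-covers some
ball of radius R' (a SOLID ball: every point of the ball within r₁ of X) is two-way δ-matched on
some ball of radius R to a rigid image of some P_l (bulk positional order for μ-stable solid LJ
matter at coexistence; card C1 restricted to solid states). [difficulty: XL] -/
@[route_item "route-AtomisticToContinuum-CoexistenceMuGSC"]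
def SolidMuGSCCrystalline : Prop :=
  let UD : Set (EuclideanSpace ℝ (Fin 3)) → Prop := fun X => ∃ δ : ℝ, 0 < δ ∧ ∀ x ∈ X, ∀ y ∈ X, x ≠ y → δ ≤ dist x y; let Match : ℝ → ℝ → EuclideanSpace ℝ (Fin 3) → Set (EuclideanSpace ℝ (Fin 3)) → Set (EuclideanSpace ℝ (Fin 3)) → Prop := fun δ R c A S => (∀ s ∈ S, dist s c ≤ R → ∃ a ∈ A, dist a s ≤ δ) ∧ (∀ a ∈ A, dist a c ≤ R → ∃ s ∈ S, dist a s ≤ δ); let MuGSC : ℝ → Set (EuclideanSpace ℝ (Fin 3)) → Prop := fun μ X => (∀ r : EuclideanSpace ℝ (Fin 3), Summable fun y : X => Literature.MathematicalPhysics.StatisticalMechanics.lennardJones (dist r y)) ∧ ∀ (n : ℕ) (xf : Fin n → EuclideanSpace ℝ (Fin 3)), Function.Injective xf → Set.range xf ⊆ X → ∀ (k : ℕ) (R : Fin k → EuclideanSpace ℝ (Fin 3)), Function.Injective R → Disjoint (Set.range R) (X \ Set.range xf) → Literature.MathematicalPhysics.StatisticalMechanics.interactionEnergy Literature.MathematicalPhysics.StatisticalMechanics.lennardJones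 xf + (∑ i, ∑' y : ↥(X \ Set.range xf), Literature.MathematicalPhysics.StatisticalMechanics.lennardJones (dist (xf i) y)) - μ * n ≤ Literature.MathematicalPhysics.StatisticalMechanics.interactionEnergy Literature.MathematicalPhysics.StatisticalMechanics.lennardJones R + (∑ i, ∑' y : ↥(X \ Set.range xf), Literature.MathematicalPhysics.StatisticalMechanics.lennardJones (dist (R i) y)) - μ * k; ∀ e : ℝ, Filter.Tendsto (fun N : ℕ => Literature.MathematicalPhysics.StatisticalMechanics.groundStateEnergy Literature.MathematicalPhysics.StatisticalMechanics.lennardJones 3 N / N) Filter.atTop (nhds e) → ∀ r₁ : ℝ, 0 < r₁ → ∃ (m : ℕ) (P : Fin m → Literature.MathematicalPhysics.StatisticalMechanics.PeriodicConfiguration 3), ∀ R δ : ℝ, 0 < R → 0 < δ → ∃ R' : ℝ, ∀ X : Set (EuclideanSpace ℝ (Fin 3)), UD X → MuGSC e X → (∃ c : EuclideanSpace ℝ (Fin 3), ∀ z : EuclideanSpace ℝ (Fin 3), dist z c ≤ R' → ∃ x ∈ X, dist x z ≤ r₁) → ∃ (l : Fin m) (g : EuclideanSpace ℝ (Fin 3)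 ≃ᵃⁱ[ℝ] EuclideanSpace ℝ (Fin 3)) (c : EuclideanSpace ℝ (Fin 3)), Match δ R c X (g '' (P l).points)

/-- item stmt-AtomisticToContinuum-4121 · crux · rank 3 · closed · moot by None · by planner
why it might fail: Positivity of the LJ crystal–vacuum surface tension in finite-volume pointwise form: fails iff a porous, slab-, needle- or sponge-like configuration is μ-stable at μ=e*; no rigorous σ>0 or hole-pricing bound exists off-lattice in 3-D (2-D: AuYeung–Friesecke–Schmidt; 3-D only on FCC/HCP lattices).
sources: AuYeungFrieseckeSchmidt2012, Schmidt2013, doi:10.1007/s00220-023-04788-5, doi:10.1098/rsta.1951.0006, HeitmannRadin1980, BlancLewin2015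
[crux] for e = lim E(N)/N there is r₁ > 0 such that every non-empty uniformly discrete μGSC of
Lennard-Jones at μ = e contains, for every R', a ball of radius R' each point of which lies within
r₁ of the configuration (coexistence μGSCs are solid somewhere at every scale: no slabs, needles,
foams or sponges — the finite-volume content of positive crystal/vacuum surface tension, via removal
of large chunks and insertion into cavities). [difficulty: L] -/
@[route_item "route-AtomisticToContinuum-CoexistenceMuGSC"]
def MuGSCSolidBalls : Prop :=
  let UD : Set (EuclideanSpace ℝ (Fin 3)) → Prop := fun X => ∃ δ : ℝ, 0 < δ ∧ ∀ x ∈ X, ∀ y ∈ X, x ≠ y → δ ≤ dist x y; let MuGSC : ℝ → Set (EuclideanSpace ℝ (Fin 3)) → Prop := fun μ X => (∀ r : EuclideanSpace ℝ (Fin 3), Summable fun y : X => Literature.MathematicalPhysics.StatisticalMechanics.lennardJones (dist r y)) ∧ ∀ (n : ℕ) (xf : Fin n → EuclideanSpace ℝ (Fin 3)), Function.Injective xf → Set.range xf ⊆ X → ∀ (k : ℕ) (R : Fin k → EuclideanSpace ℝ (Fin 3)), Function.Injective R → Disjoint (Set.range R) (X \ Set.range xf) → Literature.MathematicalPhysics.StatisticalMechanics.interactionEnergy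 Literature.MathematicalPhysics.StatisticalMechanics.lennardJones xf + (∑ i, ∑' y : ↥(X \ Set.range xf), Literature.MathematicalPhysics.StatisticalMechanics.lennardJones (dist (xf i) y)) - μ * n ≤ Literature.MathematicalPhysics.StatisticalMechanics.interactionEnergy Literature.MathematicalPhysics.StatisticalMechanics.lennardJones R + (∑ i, ∑' y : ↥(X \ Set.range xf), Literature.MathematicalPhysics.StatisticalMechanics.lennardJones (dist (R i) y)) - μ * k; ∀ e : ℝ, Filter.Tendsto (fun N : ℕ => Literature.MathematicalPhysics.StatisticalMechanics.groundStateEnergy Literature.MathematicalPhysics.StatisticalMechanics.lennardJones 3 N / N) Filter.atTop (nhds e) → ∃ r₁ : ℝ, 0 < r₁ ∧ ∀ X : Set (EuclideanSpace ℝ (Fin 3)), X.Nonempty → UD X → MuGSC e X → ∀ R' : ℝ, ∃ c : EuclideanSpace ℝ (Fin 3), ∀ z : EuclideanSpace ℝ (Fin 3), dist z c ≤ R' → ∃ x ∈ X, dist x z ≤ r₁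

/-- item stmt-AtomisticToContinuum-0629 · support · rank 9 · closed · moot by None · by planner
sources: BlancLewin2015, stmt-AtomisticToContinuum-0629
Easy half of energetic crystallization: limsup E(N)/N ≤ ⨅ over periodic configurations of the LJ
energy per particle (finite blocks of a near-optimal periodic configuration as trial states;
boundary O(N^{2/3}); r⁻⁶ tail summable in d = 3; needs BddBelow of the range, from LJ stability). -/
@[route_item "route-AtomisticToContinuum-CoexistenceMuGSC"]
def CrysEnergyUpper : Prop :=
  Filter.limsup (fun N : ℕ => Literature.MathematicalPhysics.StatisticalMechanics.groundStateEnergy Literature.MathematicalPhysics.StatisticalMechanics.lennardJones 3 N / N) Filter.atTop ≤ ⨅ Q : Literature.MathematicalPhysics.StatisticalMechanics.PeriodicConfiguration 3, Q.energyPerParticle Literature.MathematicalPhysics.StatisticalMechanics.lennardJones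

/-- item stmt-AtomisticToContinuum-0714 · support · rank 9 · closed · proved by Summit.AtomisticToContinuum.Crystallization.Theorems.crysPeriodicBddBelow_proof (prover) · by planner
sources: BlancLewin2015, stmt-AtomisticToContinuum-0714, Literature.MathematicalPhysics.StatisticalMechanics.lennardJones_stable_holds
The Lennard-Jones energy per particle of periodic configurations of ℝ³ (any full-rank lattice, any
finite motif) is bounded below (by −B, the stability constant: finite blocks of Q as N-point
configurations, boundary O(N^{2/3}), r⁻⁶ tail summable in d = 3). Makes ⨅_Q e(Q) a genuine infimum
(ciInf_le usable) in 0626/0629 and in the periodisation lemma. -/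
@[route_item "route-AtomisticToContinuum-CoexistenceMuGSC"]
def CrysPeriodicBddBelow : Prop :=
  BddBelow (Set.range fun Q : Literature.MathematicalPhysics.StatisticalMechanics.PeriodicConfiguration 3 => Q.energyPerParticle Literature.MathematicalPhysics.StatisticalMechanics.lennardJones)

/-- item stmt-AtomisticToContinuum-4127 · support · rank 9 · closed · moot by None · by planner
sources: BlancLewin2015, Summits/AtomisticToContinuum/Crystallization/Ideas/grand-canonical-selection-coexistence.md
[support] SELECTION LEMMA + GRAND STABILITY (card S1+S2): if E(N)/N → e and e ≤ E(N)/N for all N ≥ 1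
(both in tree: BlancLewin2015_8_holds), there is a strictly increasing φ such that for every j and
every M with |M − φ(j)| ≤ j: E(φ j) − e·φ(j) ≤ E(M) − e·M + 1/(j+1). Proof: a_N := E(N) − N e ≥ 0
with a_N/N → 0; fix j, pick L with max_{N ≤ 3L} a_N ≤ L/(4j(j+1)); descend from N₀ = 2L by steps of
length ≤ j lowering a by > 1/(j+1): at most a_{N₀}(j+1) ≤ L/(4j) steps, displacement < L/4, so the
chain stops inside (7L/4, 9L/4) at a (1/(j+1), j)-local minimum; these exist beyond every bound,
choose φ increasing. No bounded increments and no N^{2/3} law are needed (the card's version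
silently used attainment). [difficulty: provable-now] -/
@[route_item "route-AtomisticToContinuum-CoexistenceMuGSC"]
def SelectedGrandStability : Prop :=
  ∀ e : ℝ, Filter.Tendsto (fun N : ℕ => Literature.MathematicalPhysics.StatisticalMechanics.groundStateEnergy Literature.MathematicalPhysics.StatisticalMechanics.lennardJones 3 N / N) Filter.atTop (nhds e) → (∀ N : ℕ, 0 < N → e ≤ Literature.MathematicalPhysics.StatisticalMechanics.groundStateEnergy Literature.MathematicalPhysics.StatisticalMechanics.lennardJones 3 N / N) → ∃ φ : ℕ → ℕ, StrictMono φ ∧ ∀ j M : ℕ, φ j ≤ M + j → M ≤ φ j + j → Literature.MathematicalPhysics.StatisticalMechanics.groundStateEnergy Literature.MathematicalPhysics.StatisticalMechanics.lennardJones 3 (φ j) - e * (φ j) ≤ Literature.MathematicalPhysics.StatisticalMechanics.groundStateEnergy Literature.MathematicalPhysics.StatisticalMechanics.lennardJones 3 M - e * M + 1 / ((j : ℝ) + 1)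

/-- item stmt-AtomisticToContinuum-4128 · support · rank 9 · closed · moot by None · by planner
sources: Radin2004, BellissardRadinShlosman2010, Suto2006, BlancLewin2015, Xue1997
[support] μGSC LIMITS (card S3): given e and a strictly increasing φ₀ with the grand-stability
windows of SelectedGrandStability, every sequence of LJ ground states x^N admits a subsequence φ (of
φ₀), translations τ_j (minus a particle position) and a set X ∋ 0, uniformly discrete, which is a
μGSC at μ = e (summable LJ fields; stable under every finite modification with arbitrary
particle-number change, inserted points distinct and off the rest) and to which x^{φ j} + τ_j
converges locally: for all R, δ, eventually two-way δ-matching on B_R(0). Proof: uniform minimal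
distance (LennardJonesMinimalDistance_holds) ⇒ Chabauty/diagonal compactness of δ-separated pointed
sets; a finite modification of X is shadowed for large j by a modification of x^{φ j} changing the
particle number by k − n ≤ j, whose cost is ≥ −1/(j+1) by grand stability (E(y) ≥ E(#y) via
groundStateEnergy_lennardJones_le); pass to the limit with continuity of V_LJ off 0 and the uniform
r⁻⁶ tail bound for δ-separated sets (shell counting as in sum_inv_pow_six_le). [difficulty: L] -/
@[route_item "route-AtomisticToContinuum-CoexistenceMuGSC"]
def MuGSCLimitExtraction : Prop :=
  let UD : Set (EuclideanSpace ℝ (Fin 3)) → Prop := fun X => ∃ δ : ℝ, 0 < δ ∧ ∀ x ∈ X, ∀ y ∈ X, x ≠ y → δ ≤ dist x y; let Match : ℝ → ℝ → EuclideanSpace ℝ (Fin 3) → Set (EuclideanSpace ℝ (Fin 3)) → Set (EuclideanSpace ℝ (Fin 3)) → Prop := fun δ R c A S => (∀ s ∈ S, dist s c ≤ R → ∃ a ∈ A, dist a s ≤ δ) ∧ (∀ a ∈ A, dist a c ≤ R → ∃ s ∈ S, dist a s ≤ δ); let MuGSC : ℝ → Set (EuclideanSpace ℝ (Fin 3)) →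 Prop := fun μ X => (∀ r : EuclideanSpace ℝ (Fin 3), Summable fun y : X => Literature.MathematicalPhysics.StatisticalMechanics.lennardJones (dist r y)) ∧ ∀ (n : ℕ) (xf : Fin n → EuclideanSpace ℝ (Fin 3)), Function.Injective xf → Set.range xf ⊆ X → ∀ (k : ℕ) (R : Fin k → EuclideanSpace ℝ (Fin 3)), Function.Injective R → Disjoint (Set.range R) (X \ Set.range xf) → Literature.MathematicalPhysics.StatisticalMechanics.interactionEnergy Literature.MathematicalPhysics.StatisticalMechanics.lennardJones xf + (∑ i, ∑' y : ↥(X \ Set.range xf), Literature.MathematicalPhysics.StatisticalMechanics.lennardJones (dist (xf i) y)) - μ * n ≤ Literature.MathematicalPhysics.StatisticalMechanics.interactionEnergy Literature.MathematicalPhysics.StatisticalMechanics.lennardJones R + (∑ i, ∑' y : ↥(X \ Set.range xf), Literature.MathematicalPhysics.StatisticalMechanics.lennardJones (dist (R i) y)) - μ * k; ∀ (e : ℝ) (φ₀ : ℕ → ℕ), StrictMono φ₀ → (∀ j M : ℕ, φ₀ j ≤ M + j → M ≤ φ₀ j + j → Literature.MathematicalPhysics.StatisticalMechanics.groundStateEnergy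 Literature.MathematicalPhysics.StatisticalMechanics.lennardJones 3 (φ₀ j) - e * (φ₀ j) ≤ Literature.MathematicalPhysics.StatisticalMechanics.groundStateEnergy Literature.MathematicalPhysics.StatisticalMechanics.lennardJones 3 M - e * M + 1 / ((j : ℝ) + 1)) → ∀ x : (N : ℕ) → (Fin N → EuclideanSpace ℝ (Fin 3)), (∀ N, Literature.MathematicalPhysics.StatisticalMechanics.IsGroundState Literature.MathematicalPhysics.StatisticalMechanics.lennardJones (x N)) → ∃ (φ : ℕ → ℕ) (τ : ℕ → EuclideanSpace ℝ (Fin 3)) (X : Set (EuclideanSpace ℝ (Fin 3))), StrictMono φ ∧ (0 : EuclideanSpace ℝ (Fin 3)) ∈ X ∧ UD X ∧ MuGSC e X ∧ (∀ R δ : ℝ, 0 < R → 0 < δ → ∀ᶠ j in Filter.atTop, Match δ R 0 (Set.range fun i : Fin (φ j) => x (φ j) i + τ j) X)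

/-- item stmt-AtomisticToContinuum-4129 · support · rank 9 · closed · moot by None · by planner
sources: BlancLewin2015, Literature.MathematicalPhysics.StatisticalMechanics.PeriodicConfiguration.tendsto_sum_of_eventually_near'
[support] WINDOW LEMMA (card assembly step; the μ-analogue of DefectVanishCrystallizes 0752): if
every LJ ground-state sequence has a subsequence converging locally (two-way matching on balls
around 0, after translations) to a uniformly discrete set X which carries, for a finite family
P₁..P_m and all R, δ, a ball two-way δ-matched to a rigid image of some P_l, then IsCrystallizing
lennardJones 3. Proof: pigeonhole a fixed l along (R_k, δ_k) = (k, 1/k); re-centre at the good balls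
(τ'_k = τ_{j_k} − c_k, lattice part of the translation absorbed by P-invariance, bounded remainder
and the O(3)-part converge along a subsequence: PeriodicConfiguration.isometryImage / translate);
compose matchings with radius margins; the uniform minimal distance of ground states
(LennardJonesMinimalDistance_holds) and tendsto_sum_of_eventually_near' (CrystallizationLocalLimit,
in tree) give local weak-* convergence to Σ_{s ∈ A(P_l)+t} δ_s with multiplicity 1. [difficulty: M] -/
@[route_item "route-AtomisticToContinuum-CoexistenceMuGSC"]
def WindowsCrystallize : Prop :=
  let UD : Set (EuclideanSpace ℝ (Fin 3)) → Prop := fun X => ∃ δ : ℝ, 0 < δ ∧ ∀ x ∈ X, ∀ y ∈ X, x ≠ y → δ ≤ dist x y; let Match : ℝ → ℝ → EuclideanSpace ℝ (Fin 3) → Set (EuclideanSpace ℝ (Fin 3)) → Set (EuclideanSpace ℝ (Fin 3)) → Prop := fun δ R c A S => (∀ s ∈ S, dist s c ≤ R → ∃ a ∈ A, dist a s ≤ δ) ∧ (∀ a ∈ A, dist a c ≤ R → ∃ s ∈ S, dist a s ≤ δ); (∀ x : (N : ℕ) → (Fin N → EuclideanSpace ℝ (Fin 3)), (∀ N, Literature.MathematicalPhysics.StatisticalMechanics.IsGroundState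 Literature.MathematicalPhysics.StatisticalMechanics.lennardJones (x N)) → ∃ (φ : ℕ → ℕ) (τ : ℕ → EuclideanSpace ℝ (Fin 3)) (X : Set (EuclideanSpace ℝ (Fin 3))), StrictMono φ ∧ UD X ∧ (∀ R δ : ℝ, 0 < R → 0 < δ → ∀ᶠ j in Filter.atTop, Match δ R 0 (Set.range fun i : Fin (φ j) => x (φ j) i + τ j) X) ∧ ∃ (m : ℕ) (P : Fin m → Literature.MathematicalPhysics.StatisticalMechanics.PeriodicConfiguration 3), ∀ R δ : ℝ, 0 < R → 0 < δ → ∃ (l : Fin m) (g : EuclideanSpace ℝ (Fin 3) ≃ᵃⁱ[ℝ] EuclideanSpace ℝ (Fin 3)) (c : EuclideanSpace ℝ (Fin 3)), Match δ R c X (g '' (P l).points)) → Literature.MathematicalPhysics.StatisticalMechanics.IsCrystallizing Literature.MathematicalPhysics.StatisticalMechanics.lennardJones 3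

/-- item stmt-AtomisticToContinuum-4130 · support · rank 9 · closed · moot by None · by planner
sources: Suto2006, BlancLewin2015, Literature.MathematicalPhysics.StatisticalMechanics.PeriodicConfiguration.hasSum_lennardJones_dist_three
[support] PINNING ⇒ ATTAINMENT (card: "one line because removal is allowed"): if a uniformly
discrete X is μ-stable (any μ) and contains, for all R, δ, a ball two-way δ-matched to a rigid image
of a fixed periodic Q, then e(Q) ≤ μ. Proof: removal test on W = X ∩ B_R(c): U(W) + I(W, X∖W) ≤
μ·n_W; I(W, X∖W) ≥ −C_X R² (δ_X-separation, r⁻⁶ tail across a sphere); U(W) ≥ U(Q-window) − C n_W δ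
(energy Lipschitz in positions at separation ≥ δ_Q/2) and U(Q-window ∩ B_R) = n_W e(Q) + O(R²) (each
motif class counted n_W/#F + O(R²) times; hasSum_lennardJones_dist_three); divide by n_W ≍ R³ and
let R → ∞, δ → 0. With CrysEnergyUpper + CrysPeriodicBddBelow (e ≤ e(Q) ∀ Q) this yields IsLeast and
E(N)/N → e(P_l) for any P_l charged by a μGSC limit. [difficulty: L] -/
@[route_item "route-AtomisticToContinuum-CoexistenceMuGSC"]
def PinnedPeriodicAttains : Prop :=
  let UD : Set (EuclideanSpace ℝ (Fin 3)) → Prop := fun X => ∃ δ : ℝ, 0 < δ ∧ ∀ x ∈ X, ∀ y ∈ X, x ≠ y → δ ≤ dist x y; let Match : ℝ → ℝ → EuclideanSpace ℝ (Fin 3) → Set (EuclideanSpace ℝ (Fin 3)) → Set (EuclideanSpace ℝ (Fin 3)) → Prop := fun δ R c A S => (∀ s ∈ S, dist s c ≤ R → ∃ a ∈ A, dist a s ≤ δ) ∧ (∀ a ∈ A, dist a c ≤ R → ∃ s ∈ S, dist a s ≤ δ); let MuGSC : ℝ → Set (EuclideanSpace ℝ (Fin 3)) → Prop := fun μ X =>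 (∀ r : EuclideanSpace ℝ (Fin 3), Summable fun y : X => Literature.MathematicalPhysics.StatisticalMechanics.lennardJones (dist r y)) ∧ ∀ (n : ℕ) (xf : Fin n → EuclideanSpace ℝ (Fin 3)), Function.Injective xf → Set.range xf ⊆ X → ∀ (k : ℕ) (R : Fin k → EuclideanSpace ℝ (Fin 3)), Function.Injective R → Disjoint (Set.range R) (X \ Set.range xf) → Literature.MathematicalPhysics.StatisticalMechanics.interactionEnergy Literature.MathematicalPhysics.StatisticalMechanics.lennardJones xf + (∑ i, ∑' y : ↥(X \ Set.range xf), Literature.MathematicalPhysics.StatisticalMechanics.lennardJones (dist (xf i) y)) - μ * n ≤ Literature.MathematicalPhysics.StatisticalMechanics.interactionEnergy Literature.MathematicalPhysics.StatisticalMechanics.lennardJones R + (∑ i, ∑' y : ↥(X \ Set.range xf), Literature.MathematicalPhysics.StatisticalMechanics.lennardJones (dist (R i) y)) - μ * k; ∀ (μ : ℝ) (X : Set (EuclideanSpace ℝ (Fin 3))), UD X → MuGSC μ X → ∀ Q : Literature.MathematicalPhysics.StatisticalMechanics.PeriodicConfiguration 3, (∀ R δ : ℝ, 0 < R → 0 <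 δ → ∃ (g : EuclideanSpace ℝ (Fin 3) ≃ᵃⁱ[ℝ] EuclideanSpace ℝ (Fin 3)) (c : EuclideanSpace ℝ (Fin 3)), Match δ R c X (g '' Q.points)) → Q.energyPerParticle Literature.MathematicalPhysics.StatisticalMechanics.lennardJones ≤ μ

/-- item stmt-AtomisticToContinuum-4131 · support · rank 9 · closed · moot by None · by planner
sources: doi:10.1098/rsta.1951.0006, BlancLewin2015, Literature.MathematicalPhysics.StatisticalMechanics.siteEnergy_nonpos_of_isGroundState
[support] TWO-SIDED KOSSEL BOUNDS AT SELECTED N (card S4; delivers the open pointwise item of card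
kossel-squeeze-surface-relations): if N = n+1 is a (ε,1)-local minimum of E(·) − e·(·) (both
neighbours), then in every N-particle LJ ground state (R) every particle has site energy Σ_{k≠i}
V(r_ik) ≤ e + ε — no atom bound by less than the kink value |e| — and (I) every empty point y binds
by at most |e| + ε: Σ_i V(|y − x_i|) ≥ e − ε. Proof: delete particle i (energy E − site_i ≥ E(n))
resp. insert y (energy E + Σ_i V ≥ E(n+2)) and use the two window inequalities; siteEnergy and the
removal bookkeeping are in LennardJonesClusters.lean. Along SelectedGrandStability's φ, ε = 1/(j+1).
[difficulty: provable-now] -/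
@[route_item "route-AtomisticToContinuum-CoexistenceMuGSC"]
def KosselPointwise : Prop :=
  ∀ (e ε : ℝ) (n : ℕ), Literature.MathematicalPhysics.StatisticalMechanics.groundStateEnergy Literature.MathematicalPhysics.StatisticalMechanics.lennardJones 3 (n + 1) - e * ((n : ℝ) + 1) ≤ Literature.MathematicalPhysics.StatisticalMechanics.groundStateEnergy Literature.MathematicalPhysics.StatisticalMechanics.lennardJones 3 n - e * (n : ℝ) + ε → Literature.MathematicalPhysics.StatisticalMechanics.groundStateEnergy Literature.MathematicalPhysics.StatisticalMechanics.lennardJones 3 (n + 1) - e * ((n : ℝ) + 1) ≤ Literature.MathematicalPhysics.StatisticalMechanics.groundStateEnergy Literature.MathematicalPhysics.StatisticalMechanics.lennardJones 3 (n + 2) - e * ((n : ℝ) + 2) + ε → ∀ x : Fin (n + 1) → EuclideanSpace ℝ (Fin 3), Literature.MathematicalPhysics.StatisticalMechanics.IsGroundState Literature.MathematicalPhysics.StatisticalMechanics.lennardJones x → (∀ i, Literature.MathematicalPhysics.StatisticalMechanics.siteEnergy Literature.MathematicalPhysics.StatisticalMechanics.lennardJones x i ≤ e + ε) ∧ ∀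 y : EuclideanSpace ℝ (Fin 3), y ∉ Set.range x → e - ε ≤ ∑ i, Literature.MathematicalPhysics.StatisticalMechanics.lennardJones (dist y (x i))

/-- item stmt-AtomisticToContinuum-4132 · assembly · rank 1 · closed · moot by None · by planner
sources: BlancLewin2015, Literature.MathematicalPhysics.StatisticalMechanics.BlancLewin2015_8_holds, Literature.MathematicalPhysics.StatisticalMechanics.LennardJonesGroundStatesExist_holds
[assembly] SolidMuGSCCrystalline → MuGSCSolidBalls → SelectedGrandStability → MuGSCLimitExtraction →
WindowsCrystallize → PinnedPeriodicAttains → CrysEnergyUpper → CrysPeriodicBddBelow →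
Crystallization. -/
@[route_item "route-AtomisticToContinuum-CoexistenceMuGSC"]
def Assembly : Prop :=
  SolidMuGSCCrystalline → MuGSCSolidBalls → SelectedGrandStability → MuGSCLimitExtraction → WindowsCrystallize → PinnedPeriodicAttains → CrysEnergyUpper → CrysPeriodicBddBelow → Literature.MathematicalPhysics.StatisticalMechanics.Crystallization

end Summit.AtomisticToContinuum.Crystallization.Theses.CoexistenceMuGSC
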